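import Summits.ABC.IUTFork.Joshi.FundamentalEstimateBLSizeFlag
import Summits.ABC.IUTFork.Joshi.FundamentalEstimateBLStandard

/-!
# [J-III] Thm. 7.3.1 / Cor. 7.4.1 at a FIXED `ρ` — the repaired statements `C′` of the sup-over-`ρ` flag, PROVED over the signature

Companion of `Joshi/FundamentalEstimateBL.lean` (p428437), `…Corollaries` (p428908), `…Standard` (p429865) and `…SizeFlag` (p430788);
abc-iut cell block E (rung LADDER-ABC:A2.E), seat abc-iut-E-t12, slot T-12 / plan/E/OBJECTS.tsv O-024, nodes J3:Def7.2.7, J3:Thm7.3.1,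
J3:Cor7.4.1. SOURCE: K. Joshi, arXiv:2401.13508**v4** (unrefereed; bib `Joshi2024ATS3`), §7.2–§7.4, PDF pp.54–57 (render
`HOME/lit/renders/Joshi-arxiv-2401.13508/`). Object-side (E-PLAN R14: no decl of OUR side is bound). P2, not on the S-spine.

WHY. `FundamentalEstimateBLSizeFlag.lean` records (as OUR READING, double-read requested) that Def. 7.2.7's `sup` over ALL `ρ ∈ (0,1]`
makes `|Θ̃^{B_{L′}}_Joshi|_{B_{L′}} = +∞` in the intended model as soon as one `λ ≠ 0` admissible lift is in the locus (Frobenius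
eigen-components have unbounded norms as `ρ → 0⁺`), so that Thm. 7.3.1's conclusion is then trivially true and Cor. 7.4.1's
"`∞ > |Φ|_{B_{L′}}`" fails (kernel: `not_cor741_flatDatum`), with the minimal repair `C′` = "sizes at a fixed `ρ`". THIS FILE types `C′` and
PROVES it over the signature — the «refuted-misstated ⇒ repaired statement + witness misses `C′`» pattern:
* `FundamentalEstimateBLAt ρ` — Thm. 7.3.1 AT `ρ`: `∏_w |q_w^{1/2ℓ}|^{ℓ*} ≤ |Θ̃^{B_{L′}}_Joshi|_{B_{L′},ρ}` — exactly what the printed proof shows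
  before "and so by definition" (p.56 l.62–109); ⟸ the local step at `ρ` (`fundamentalEstimateBLAt_of_localThetaEstimateAt`), ⟸ the
  printed norm values for every `ρ ∈ (0,1]` (`fundamentalEstimateBLAt_of_standardPointNorms`), and ⟹ the printed `sup` form
  (`fundamentalEstimateBL_of_at`).
* `Cor741At ρ` — Cor. 7.4.1 AT a fixed `0 < ρ < 1`: for a special precompact `Φ ⊆ Θ̃`, `|Φ|_{B_{L′},ρ} < ∞` and `|Φ|_{B_{L′},ρ} > ∏_w |q_w^{1/2ℓ}|^{ℓ*}`;
  the finiteness half from precompactness + continuity of `|·|_ρ` ALONE (p428908 `sizeAt_pi_lt_top` — no "evidently bounded"), the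
  strict lower bound from the local step when `𝕍^{odd,ss} ≠ ∅` (`cor741At_of_localThetaEstimateAt`, `cor741At_of_standardPointNorms`).
* The interface countermodel `flatDatum` of the PRINTED Cor. 7.4.1 (p430788: `¬ flatDatum.Cor741`) SATISFIES the repaired statement
  at every `0 < ρ < 1` (`cor741At_flatDatum`) — the witness misses `C′`.
FRAMING (binding): typed ≠ proved; no side taken on [IUTchIII] Cor. 3.12, on Joshi's claims or on Mochizuki's 2024 report; nothing here
bears on abc; `C′` is OUR repaired reading of a P2 corollary, recorded for the referee lanes (E-ref), not a claim about the author's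
intent.
-/

noncomputable section

open Set Finset

namespace Summit.ABC.IUTFork.Joshi.ATS3

namespace AdelicThetaDatum

variable (D : AdelicThetaDatum)

/-! ## 1. Theorem 7.3.1 at a fixed `ρ` -/

/-- **Thm. 7.3.1 AT `ρ` (repaired reading `C′` of J3:Thm7.3.1 / Def. 7.2.7):** `∏_{w∈𝕍^{odd,ss}} |q_w^{1/2ℓ}|^{ℓ*}_{ℂ_{p_w}} ≤ |Θ̃^{B_{L′}}_Joshi|_{B_{L′},ρ}`
— the inequality the printed proof establishes at a general `ρ` (p.56 l.62–109) before passing to the `sup` over `ρ`. OUR repaired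
reading; never asserted. [claim: Joshi2024ATS3, status: disputed] -/
def FundamentalEstimateBLAt (ρ : ℝ) : Prop := ((D.qBound : ℝ) : EReal) ≤ D.sizeAt D.locus ρ

/-- The local step at `ρ` gives Thm. 7.3.1 at `ρ` (one exhibited element; DERIVED). [folklore] -/
theorem fundamentalEstimateBLAt_of_localThetaEstimateAt {ρ : ℝ} (h : D.LocalThetaEstimateAt ρ) : D.FundamentalEstimateBLAt ρ :=
  (EReal.coe_le_coe_iff.2 (D.qBound_le_adelicSize_std h)).trans (D.adelicSize_le_sizeAt (D.Xi_mem_locus D.std) ρ)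

/-- The printed norm values at the standard point give Thm. 7.3.1 at EVERY `ρ ∈ (0,1]`, for every `ℓ ≥ 5` (DERIVED). [folklore] -/
theorem fundamentalEstimateBLAt_of_standardPointNorms (h : D.StandardPointNorms) {ρ : ℝ} (hρ : ρ ∈ Set.Ioc (0 : ℝ) 1) :
    D.FundamentalEstimateBLAt ρ :=
  D.fundamentalEstimateBLAt_of_localThetaEstimateAt (D.localThetaEstimateAt_of_standardPointNorms h hρ)

/-- Thm. 7.3.1 at some `ρ ∈ (0,1]` implies the printed (`sup`) form. [folklore] -/
theorem fundamentalEstimateBL_of_at {ρ : ℝ} (hρ : ρ ∈ Set.Ioc (0 : ℝ) 1) (h : D.FundamentalEstimateBLAt ρ) :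
    D.FundamentalEstimateBL :=
  h.trans (D.sizeAt_le_size D.locus hρ)

/-! ## 2. Corollary 7.4.1 at a fixed `ρ` -/

/-- **Cor. 7.4.1 AT `ρ` (repaired reading `C′` of J3:Cor7.4.1):** for every special precompact `Φ ⊆ Θ̃^{B_{L′}}_Joshi`,
`|Φ|_{B_{L′},ρ} < ∞` and `|Φ|_{B_{L′},ρ} > ∏_{w∈𝕍^{odd,ss}} |q_w^{1/2ℓ}|^{ℓ*}_{ℂ_{p_w}}` — the printed statement with the size read at ONE `ρ` instead
of the `sup` over `ρ ∈ (0,1]`. OUR repaired reading; never asserted. [claim: Joshi2024ATS3, status: disputed] -/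
def Cor741At (ρ : ℝ) : Prop :=
  ∀ Φ : ∀ w : D.W, Set (Fin D.lstar → D.B w), D.pi Φ ⊆ D.locus → D.IsSpecialPrecompact Φ →
    D.sizeAt (D.pi Φ) ρ < ⊤ ∧ ((D.qBound : ℝ) : EReal) < D.sizeAt (D.pi Φ) ρ

/-- **Cor. 7.4.1 at a fixed `0 < ρ < 1`, PROVED** from the local step at `ρ` (for `𝕍^{odd,ss} ≠ ∅`): finiteness by precompactness +
continuity of `|·|_ρ` alone (`sizeAt_pi_lt_top`), the strict lower bound through the distinguished element `Ξ^α_{0,z_Θ} ∈ Φ`.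
[folklore] -/
theorem cor741At_of_localThetaEstimateAt (hne : D.Vss.Nonempty) {ρ : ℝ} (hρ : ρ ∈ Set.Ioo (0 : ℝ) 1)
    (h : D.LocalThetaEstimateAt ρ) : D.Cor741At ρ := fun _Φ _ hΦ =>
  ⟨D.sizeAt_pi_lt_top hΦ hρ,
    (EReal.coe_lt_coe_iff.2 (D.qBound_lt_adelicSize_std h hne)).trans_le (D.adelicSize_le_sizeAt (D.Xi_std_mem_pi hΦ) ρ)⟩

/-- Cor. 7.4.1 at every `0 < ρ < 1` from the printed norm values at the standard point (for `𝕍^{odd,ss} ≠ ∅`, every `ℓ ≥ 5`).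
[folklore] -/
theorem cor741At_of_standardPointNorms (h : D.StandardPointNorms) (hne : D.Vss.Nonempty) {ρ : ℝ} (hρ : ρ ∈ Set.Ioo (0 : ℝ) 1) :
    D.Cor741At ρ :=
  D.cor741At_of_localThetaEstimateAt hne hρ (D.localThetaEstimateAt_of_standardPointNorms h ⟨hρ.1, hρ.2.le⟩)

/-- The repaired statement at `ρ` implies the printed LOWER bound (the `sup` dominates `sizeAt`); only the printed FINITENESS is lost.
[folklore] -/
theorem qBound_lt_size_of_cor741At {ρ : ℝ} (hρ : ρ ∈ Set.Ioc (0 : ℝ) 1) (h : D.Cor741At ρ)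
    {Φ : ∀ w : D.W, Set (Fin D.lstar → D.B w)} (hsub : D.pi Φ ⊆ D.locus) (hΦ : D.IsSpecialPrecompact Φ) :
    ((D.qBound : ℝ) : EReal) < D.size (D.pi Φ) :=
  (h Φ hsub hΦ).2.trans_le (D.sizeAt_le_size _ hρ)

end AdelicThetaDatum

/-! ## 3. The witness against the printed Cor. 7.4.1 satisfies the repaired one -/

/-- The local step of Thm. 7.3.1 holds for `flatDatum` at every `ρ ∈ (0,1]` (`|2|^{1/ρ} ≥ 1` per coordinate, `(1/2)^{1/5} < 1`). [folklore] -/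
theorem localThetaEstimateAt_flatDatum {ρ : ℝ} (hρ : ρ ∈ Set.Ioc (0 : ℝ) 1) : flatDatum.LocalThetaEstimateAt ρ := by
  intro w _
  have hlt : flatDatum.qAbs w ^ ((flatDatum.lstar : ℝ) / (2 * flatDatum.ell)) < 1 :=
    Real.rpow_lt_one (by show (0 : ℝ) ≤ 1 / 2; norm_num) (by show (1 / 2 : ℝ) < 1; norm_num)
      (by show (0 : ℝ) < ((2 : ℕ) : ℝ) / (2 * ((2 * 2 + 1 : ℕ) : ℝ)); norm_num)
  refine hlt.trans_le ?_
  show (1 : ℝ) ≤ ∏ _j : Fin 2, |(2 : ℝ)| ^ (1 / ρ)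
  rw [Fin.prod_const]
  have h2 : (1 : ℝ) ≤ |(2 : ℝ)| ^ (1 / ρ) := Real.one_le_rpow (by norm_num) (by have := hρ.1; positivity)
  exact one_le_pow₀ h2

/-- **The countermodel to the PRINTED Cor. 7.4.1 satisfies the REPAIRED Cor. 7.4.1 at every `0 < ρ < 1`** (p430788's `flatDatum`:
`¬ flatDatum.Cor741`, yet `flatDatum.Cor741At ρ`): the witness exploits exactly the `sup` over `ρ` and nothing else — «misstated-class,
repair `C′` typed and proved, witness misses `C′`». [folklore] -/
theorem cor741At_flatDatum {ρ : ℝ} (hρ : ρ ∈ Set.Ioo (0 : ℝ) 1) : flatDatum.Cor741At ρ :=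
  flatDatum.cor741At_of_localThetaEstimateAt ⟨(), Finset.mem_univ (α := Unit) ()⟩ hρ
    (localThetaEstimateAt_flatDatum ⟨hρ.1, hρ.2.le⟩)

/-- Side by side: the printed Corollary fails and the repaired one holds on the same datum. [folklore] -/
theorem cor741_repair_profile {ρ : ℝ} (hρ : ρ ∈ Set.Ioo (0 : ℝ) 1) : ¬ flatDatum.Cor741 ∧ flatDatum.Cor741At ρ :=
  ⟨not_cor741_flatDatum, cor741At_flatDatum hρ⟩

end Summit.ABC.IUTFork.Joshi.ATS3

end
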